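import Literature.Analysis.FluidPDE.PlanarPullbackKinematics
import Mathlib.Analysis.Calculus.ContDiff.Operations
import HarnessLib

/-!
# Eulerian pullback kinematics in the plane, II: derivatives of the primitive moves and
packaged transport statements

Topic `Literature/Analysis/FluidPDE`; companion of `PlanarPullbackKinematics.lean` (same
namespace `Literature.Analysis.FluidPDE.PlanarKinematics`). That file gives the explicit
primitive moves of planar incompressible kinematics as pairs (pullback map `Ψ`, Eulerian
velocity `V`) — shears `Ψ = (x - φ(t,y), y)`, `V = (∂ₜφ, 0)` and axial stretches
`Ψ = (Ξ(t,x), c + (y-c)/Ξₓ)`, `V = (g, -(y-c)gₓ)`, `g = -Ξₜ/Ξₓ` — with their pullback identities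
`∂ₜΨ + D_zΨ[V] = 0` and `div V = 0`. Here the time and space derivatives of the three pullback
maps are recorded as standalone `HasDerivAt` / `HasFDerivAt` statements
(`hasDerivAt_hShearPullback`, `hasFDerivAt_hShearPullback`, `hasDerivAt_vShearPullback`,
`hasFDerivAt_vShearPullback`, `hasDerivAt_axialPullback`, `hasFDerivAt_axialPullback`), and the
statement a block construction actually consumes is packaged: **for every profile `Θ_ref`
differentiable at `Ψ(t,z)`, the composite `Θ_ref ∘ Ψ` satisfies the transport equation
`∂ₜΘ + DΘ[V] = 0` at `(t,z)` with the move's velocity** (`transport_comp_hShearPullback`,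
`transport_comp_vShearPullback`, `transport_comp_axialPullback`; from
`transport_comp_of_pullback` and the identities). Also: the smoothness of
the moves jointly in `(t, z)` from that of their one-dimensional data
(`contDiff_uncurry_hShearPullback`, `contDiff_uncurry_axialPullback`,
`contDiff_uncurry_axialVelocity`, `contDiff_uncurry_axialRate(Deriv)`, …), which is what the
fields `smooth_velocity`/`smooth_scalar` of `QuasiSelfSimilar.IsCompatibleBlockSystem` ask, and
the bridge `vec2 a b = !₂[a, b]` to Mathlib's Euclidean literal (`vec2_eq_euclidean_lit`).
Everything is proved; no definitions, no named facts.

Usage (the shared gate field of the quasi-self-similar blocks, checked in the author's scratch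
file): with `Ξ(t,x) = ℓ(t)x` the axial velocity is the cut-off hyperbolic squeeze
`(-(ℓ'/ℓ) u₀, (ℓ'/ℓ) u₁)`, and `transport_comp_axialPullback` gives the transport of
`prof(u₁/ℓ(t))` in the channel band in five lines.

## References

* G. Alberti, G. Crippa, A. L. Mazzucato, *Exponential self-similar mixing by incompressible
  flows*, J. Amer. Math. Soc. 32 (2019), 445–490, §§7–8 (arXiv:1605.02090).
* E. Bruè, C. De Lellis, *Anomalous dissipation for the forced 3D Navier–Stokes equations*,
  Comm. Math. Phys. 400 (2023), 1507–1533, §4 (arXiv:2207.06301).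
-/

noncomputable section

open Function Set Filter
open scoped Topology ContDiff

namespace Literature.Analysis.FluidPDE

namespace PlanarKinematics

local notation "E²" => EuclideanSpace ℝ (Fin 2)

variable {G : Type*} [NormedAddCommGroup G] [NormedSpace ℝ G]

/-! ## Bridge to the Euclidean literal -/

/-- **Bridge to Mathlib's literal**: `vec2 a b` is the Euclidean literal `!₂[a, b]`, so that
Mathlib's lemmas about the literal apply after `simp [vec2_eq_euclidean_lit]`. [folklore] -/
theorem vec2_eq_euclidean_lit (a b : ℝ) : vec2 a b = !₂[a, b] := by
  ext j
  fin_cases j <;> simp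

/-! ## Derivatives of the primitive pullbacks and packaged transport statements -/

/-- **Time derivative of the horizontal shear pullback**: `∂ₜΨ(t,z) = (-∂ₜφ(t,z₁), 0)`.
[folklore] -/
theorem hasDerivAt_hShearPullback {φ φt : ℝ → ℝ → ℝ} {t : ℝ} {z : E²}
    (ht : HasDerivAt (fun s => φ s (z 1)) (φt t (z 1)) t) :
    HasDerivAt (fun s => hShearPullback φ s z) (vec2 (-φt t (z 1)) 0) t := by
  have h := hasDerivAt_vec2 ((hasDerivAt_const t (z 0)).sub ht) (hasDerivAt_const t (z 1))
  simp only [zero_sub] at h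
  exact h

/-- **Space derivative of the horizontal shear pullback**: `D_zΨ(t,z)[v] = (v₀ - ∂_yφ v₁, v₁)`.
[folklore] -/
theorem hasFDerivAt_hShearPullback {φ : ℝ → ℝ → ℝ} {t φy : ℝ} {z : E²}
    (hy : HasDerivAt (φ t) φy (z 1)) :
    HasFDerivAt (hShearPullback φ t)
      (((1 : ℝ) • (EuclideanSpace.proj (0 : Fin 2) : E² →L[ℝ] ℝ) +
          (0 - φy) • (EuclideanSpace.proj (1 : Fin 2) : E² →L[ℝ] ℝ)).smulRight
          (EuclideanSpace.single 0 1) +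
        (EuclideanSpace.proj (1 : Fin 2) : E² →L[ℝ] ℝ).smulRight (EuclideanSpace.single 1 1)) z := by
  have hg : DifferentiableAt ℝ (uncurry fun a b : ℝ => a - φ t b) (z 0, z 1) :=
    differentiableAt_fst.sub (hy.differentiableAt.comp (z 0, z 1) differentiableAt_snd)
  have hP : HasFDerivAt (fun w : E² => w 0 - φ t (w 1))
      ((1 : ℝ) • (EuclideanSpace.proj (0 : Fin 2) : E² →L[ℝ] ℝ) +
        (0 - φy) • (EuclideanSpace.proj (1 : Fin 2) : E² →L[ℝ] ℝ)) z :=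
    hasFDerivAt_coordFun (g := fun a b : ℝ => a - φ t b) hg ((hasDerivAt_id (z 0)).sub_const _)
      ((hasDerivAt_const (z 1) (z 0)).sub hy)
  have hQ : HasFDerivAt (fun w : E² => w 1) (EuclideanSpace.proj (1 : Fin 2) : E² →L[ℝ] ℝ) z :=
    (EuclideanSpace.proj (1 : Fin 2) : E² →L[ℝ] ℝ).hasFDerivAt
  exact hasFDerivAt_vec2 hP hQ

/-- **Time derivative of the vertical shear pullback**: `∂ₜΨ(t,z) = (0, -∂ₜφ(t,z₀))`.
[folklore] -/
theorem hasDerivAt_vShearPullback {φ φt : ℝ → ℝ → ℝ} {t : ℝ} {z : E²}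
    (ht : HasDerivAt (fun s => φ s (z 0)) (φt t (z 0)) t) :
    HasDerivAt (fun s => vShearPullback φ s z) (vec2 0 (-φt t (z 0))) t := by
  have h := hasDerivAt_vec2 (hasDerivAt_const t (z 0)) ((hasDerivAt_const t (z 1)).sub ht)
  simp only [zero_sub] at h
  exact h

/-- **Space derivative of the vertical shear pullback**: `D_zΨ(t,z)[v] = (v₀, v₁ - ∂ₓφ v₀)`.
[folklore] -/
theorem hasFDerivAt_vShearPullback {φ : ℝ → ℝ → ℝ} {t φx : ℝ} {z : E²}
    (hx : HasDerivAt (φ t) φx (z 0)) :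
    HasFDerivAt (vShearPullback φ t)
      ((EuclideanSpace.proj (0 : Fin 2) : E² →L[ℝ] ℝ).smulRight (EuclideanSpace.single 0 1) +
        (((0 - φx) • (EuclideanSpace.proj (0 : Fin 2) : E² →L[ℝ] ℝ) +
          (1 : ℝ) • (EuclideanSpace.proj (1 : Fin 2) : E² →L[ℝ] ℝ))).smulRight
          (EuclideanSpace.single 1 1)) z := by
  have hg : DifferentiableAt ℝ (uncurry fun a b : ℝ => b - φ t a) (z 0, z 1) :=
    differentiableAt_snd.sub (hx.differentiableAt.comp (z 0, z 1) differentiableAt_fst)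
  have hQ : HasFDerivAt (fun w : E² => w 1 - φ t (w 0))
      ((0 - φx) • (EuclideanSpace.proj (0 : Fin 2) : E² →L[ℝ] ℝ) +
        (1 : ℝ) • (EuclideanSpace.proj (1 : Fin 2) : E² →L[ℝ] ℝ)) z :=
    hasFDerivAt_coordFun (g := fun a b : ℝ => b - φ t a) hg ((hasDerivAt_const (z 0) (z 1)).sub hx)
      ((hasDerivAt_id (z 1)).sub_const _)
  have hP : HasFDerivAt (fun w : E² => w 0) (EuclideanSpace.proj (0 : Fin 2) : E² →L[ℝ] ℝ) z :=
    (EuclideanSpace.proj (0 : Fin 2) : E² →L[ℝ] ℝ).hasFDerivAt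
  exact hasFDerivAt_vec2 hP hQ

/-- **Time derivative of the axial pullback**: `∂ₜΨ(t,z) = (Ξₜ, (z₁ - c)(-Ξₓₜ/Ξₓ²))`.
[folklore] -/
theorem hasDerivAt_axialPullback {Ξ Ξx Ξt Ξxt : ℝ → ℝ → ℝ} {c t : ℝ} {z : E²}
    (ht : HasDerivAt (fun s => Ξ s (z 0)) (Ξt t (z 0)) t)
    (hxt : HasDerivAt (fun s => Ξx s (z 0)) (Ξxt t (z 0)) t) (hne : Ξx t (z 0) ≠ 0) :
    HasDerivAt (fun s => axialPullback Ξ Ξx c s z)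
      (vec2 (Ξt t (z 0)) ((z 1 - c) * (-Ξxt t (z 0) / Ξx t (z 0) ^ 2))) t := by
  have hinvt : HasDerivAt (fun s => (Ξx s (z 0))⁻¹) (-Ξxt t (z 0) / Ξx t (z 0) ^ 2) t :=
    hxt.fun_inv hne
  have h := hasDerivAt_vec2 ht ((hasDerivAt_const t c).add (hinvt.const_mul (z 1 - c)))
  simp only [zero_add] at h
  have hfun : (fun s => axialPullback Ξ Ξx c s z) =
      fun s => vec2 (Ξ s (z 0)) (c + (z 1 - c) * (Ξx s (z 0))⁻¹) := by
    funext s; rw [axialPullback_apply, div_eq_mul_inv]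
  rw [hfun]
  exact h

/-- **Space derivative of the axial pullback**:
`D_zΨ(t,z)[v] = (Ξₓ v₀, (z₁ - c)(-Ξₓₓ/Ξₓ²) v₀ + v₁/Ξₓ)`. [folklore] -/
theorem hasFDerivAt_axialPullback {Ξ Ξx Ξxx : ℝ → ℝ → ℝ} {c t : ℝ} {z : E²}
    (hx : HasDerivAt (Ξ t) (Ξx t (z 0)) (z 0)) (hxx : HasDerivAt (Ξx t) (Ξxx t (z 0)) (z 0))
    (hne : Ξx t (z 0) ≠ 0) :
    HasFDerivAt (axialPullback Ξ Ξx c t)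
      ((Ξx t (z 0) • (EuclideanSpace.proj (0 : Fin 2) : E² →L[ℝ] ℝ) +
          (0 : ℝ) • (EuclideanSpace.proj (1 : Fin 2) : E² →L[ℝ] ℝ)).smulRight
          (EuclideanSpace.single 0 1) +
        (((z 1 - c) * (-Ξxx t (z 0) / Ξx t (z 0) ^ 2)) •
              (EuclideanSpace.proj (0 : Fin 2) : E² →L[ℝ] ℝ) +
            (Ξx t (z 0))⁻¹ • (EuclideanSpace.proj (1 : Fin 2) : E² →L[ℝ] ℝ)).smulRight
          (EuclideanSpace.single 1 1)) z := by
  have hinvx : HasDerivAt (fun a => (Ξx t a)⁻¹) (-Ξxx t (z 0) / Ξx t (z 0) ^ 2) (z 0) :=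
    hxx.fun_inv hne
  have hgP : DifferentiableAt ℝ (uncurry fun a _ : ℝ => Ξ t a) (z 0, z 1) :=
    hx.differentiableAt.comp (z 0, z 1) differentiableAt_fst
  have hP : HasFDerivAt (fun w : E² => Ξ t (w 0))
      (Ξx t (z 0) • (EuclideanSpace.proj (0 : Fin 2) : E² →L[ℝ] ℝ) +
        (0 : ℝ) • (EuclideanSpace.proj (1 : Fin 2) : E² →L[ℝ] ℝ)) z :=
    hasFDerivAt_coordFun (g := fun a _ : ℝ => Ξ t a) hgP hx (hasDerivAt_const (z 1) _)
  have hgQ : DifferentiableAt ℝ (uncurry fun a b : ℝ => c + (b - c) * (Ξx t a)⁻¹) (z 0, z 1) := by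
    have h1 : DifferentiableAt ℝ (fun p : ℝ × ℝ => Ξx t p.1) (z 0, z 1) :=
      hxx.differentiableAt.comp (z 0, z 1) differentiableAt_fst
    exact (differentiableAt_const c).add
      ((differentiableAt_snd.sub_const c).mul (h1.fun_inv hne))
  have hQ : HasFDerivAt (fun w : E² => c + (w 1 - c) * (Ξx t (w 0))⁻¹)
      (((z 1 - c) * (-Ξxx t (z 0) / Ξx t (z 0) ^ 2)) •
          (EuclideanSpace.proj (0 : Fin 2) : E² →L[ℝ] ℝ) +
        (Ξx t (z 0))⁻¹ • (EuclideanSpace.proj (1 : Fin 2) : E² →L[ℝ] ℝ)) z := by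
    have h := hasFDerivAt_coordFun (g := fun a b : ℝ => c + (b - c) * (Ξx t a)⁻¹) hgQ
      ((hasDerivAt_const (z 0) c).add (hinvx.const_mul (z 1 - c)))
      ((hasDerivAt_const (z 1) c).add (((hasDerivAt_id (z 1)).sub_const c).mul_const (Ξx t (z 0))⁻¹))
    simp only [zero_add, one_mul] at h
    exact h
  have hfun : axialPullback Ξ Ξx c t =
      fun w => vec2 (Ξ t (w 0)) (c + (w 1 - c) * (Ξx t (w 0))⁻¹) := by
    funext w; rw [axialPullback_apply, div_eq_mul_inv]
  rw [hfun]
  exact hasFDerivAt_vec2 hP hQ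

/-- **Transport by a horizontal shear**: for every profile `Θ_ref` differentiable at `Ψ(t,z)`,
`Θ_ref ∘ Ψ` is transported by the shear velocity at `(t,z)`. [folklore] -/
theorem transport_comp_hShearPullback {Θ : E² → G} {φ φt : ℝ → ℝ → ℝ} {t φy : ℝ} {z : E²}
    (hΘ : DifferentiableAt ℝ Θ (hShearPullback φ t z))
    (ht : HasDerivAt (fun s => φ s (z 1)) (φt t (z 1)) t) (hy : HasDerivAt (φ t) φy (z 1)) :
    deriv (fun s => Θ (hShearPullback φ s z)) t +
      fderiv ℝ (fun w => Θ (hShearPullback φ t w)) z (hShearVelocity φt t z) = 0 :=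
  transport_comp_of_pullback hΘ (hasDerivAt_hShearPullback ht).differentiableAt
    (hasFDerivAt_hShearPullback hy).differentiableAt (hShear_pullback_identity ht hy)

/-- **Transport by a vertical shear**. [folklore] -/
theorem transport_comp_vShearPullback {Θ : E² → G} {φ φt : ℝ → ℝ → ℝ} {t φx : ℝ} {z : E²}
    (hΘ : DifferentiableAt ℝ Θ (vShearPullback φ t z))
    (ht : HasDerivAt (fun s => φ s (z 0)) (φt t (z 0)) t) (hx : HasDerivAt (φ t) φx (z 0)) :
    deriv (fun s => Θ (vShearPullback φ s z)) t +
      fderiv ℝ (fun w => Θ (vShearPullback φ t w)) z (vShearVelocity φt t z) = 0 :=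
  transport_comp_of_pullback hΘ (hasDerivAt_vShearPullback ht).differentiableAt
    (hasFDerivAt_vShearPullback hx).differentiableAt (vShear_pullback_identity ht hx)

/-- **Transport by an axial stretch**: for every profile `Θ_ref` differentiable at `Ψ(t,z)`,
`Θ_ref ∘ Ψ` is transported at `(t,z)` by the axial velocity of the rate `-Ξₜ/Ξₓ` (hypotheses as
in `axial_pullback_identity`). Any velocity that agrees with the axial velocity at the point
(e.g. its transverse cut-off inside the channel band) can be substituted by rewriting. [folklore] -/
theorem transport_comp_axialPullback {Θ : E² → G} {Ξ Ξx Ξt Ξxx Ξxt : ℝ → ℝ → ℝ} {c t : ℝ} {z : E²}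
    (hΘ : DifferentiableAt ℝ Θ (axialPullback Ξ Ξx c t z))
    (ht : HasDerivAt (fun s => Ξ s (z 0)) (Ξt t (z 0)) t)
    (hx : HasDerivAt (Ξ t) (Ξx t (z 0)) (z 0))
    (hxx : HasDerivAt (Ξx t) (Ξxx t (z 0)) (z 0))
    (hxt : HasDerivAt (fun s => Ξx s (z 0)) (Ξxt t (z 0)) t)
    (hne : Ξx t (z 0) ≠ 0) :
    deriv (fun s => Θ (axialPullback Ξ Ξx c s z)) t +
      fderiv ℝ (fun w => Θ (axialPullback Ξ Ξx c t w)) z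
        (axialVelocity (axialRate Ξx Ξt) (axialRateDeriv Ξx Ξt Ξxx Ξxt) c t z) = 0 :=
  transport_comp_of_pullback hΘ (hasDerivAt_axialPullback ht hxt hne).differentiableAt
    (hasFDerivAt_axialPullback hx hxx hne).differentiableAt
    (axial_pullback_identity ht hx hxx hxt hne)

/-! ## Smoothness of the primitive moves

The block systems ask for `ContDiff ℝ ∞ (uncurry V)` and `ContDiff ℝ ∞ (uncurry Θ)`; the
following lemmas reduce the smoothness of the explicit moves (as functions of `(t, z)`) to that
of their one-dimensional data.
-/

section Smoothness

variable {X : Type*} [NormedAddCommGroup X] [NormedSpace ℝ X] {n : WithTop ℕ∞}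

/-- A field given by two `C^n` component functions is `C^n`. [folklore] -/
theorem contDiff_vec2 {f g : X → ℝ} (hf : ContDiff ℝ n f) (hg : ContDiff ℝ n g) :
    ContDiff ℝ n fun x => vec2 (f x) (g x) :=
  (hf.smul contDiff_const).add (hg.smul contDiff_const)

/-- The coordinate functions of `ℝ²` are smooth. [folklore] -/
theorem contDiff_coord (j : Fin 2) : ContDiff ℝ n fun z : E² => z j :=
  (EuclideanSpace.proj j : E² →L[ℝ] ℝ).contDiff

/-- **The horizontal shear pullback is as smooth as its displacement profile** (jointly in
`(t, z)`). [folklore] -/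
theorem contDiff_uncurry_hShearPullback {φ : ℝ → ℝ → ℝ} (hφ : ContDiff ℝ n (uncurry φ)) :
    ContDiff ℝ n (uncurry (hShearPullback φ)) := by
  have h1 : ContDiff ℝ n fun p : ℝ × E² => p.2 0 - uncurry φ (p.1, p.2 1) :=
    ((contDiff_coord 0).comp contDiff_snd).sub
      (hφ.comp (contDiff_fst.prodMk ((contDiff_coord 1).comp contDiff_snd)))
  have h2 : ContDiff ℝ n fun p : ℝ × E² => p.2 1 := (contDiff_coord 1).comp contDiff_snd
  exact contDiff_vec2 h1 h2

/-- **The horizontal shear velocity is as smooth as the time derivative of the profile.**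
[folklore] -/
theorem contDiff_uncurry_hShearVelocity {φt : ℝ → ℝ → ℝ} (hφ : ContDiff ℝ n (uncurry φt)) :
    ContDiff ℝ n (uncurry (hShearVelocity φt)) := by
  have h1 : ContDiff ℝ n fun p : ℝ × E² => uncurry φt (p.1, p.2 1) :=
    hφ.comp (contDiff_fst.prodMk ((contDiff_coord 1).comp contDiff_snd))
  exact contDiff_vec2 h1 contDiff_const

/-- **The vertical shear pullback is as smooth as its displacement profile.** [folklore] -/
theorem contDiff_uncurry_vShearPullback {φ : ℝ → ℝ → ℝ} (hφ : ContDiff ℝ n (uncurry φ)) :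
    ContDiff ℝ n (uncurry (vShearPullback φ)) := by
  have h1 : ContDiff ℝ n fun p : ℝ × E² => p.2 0 := (contDiff_coord 0).comp contDiff_snd
  have h2 : ContDiff ℝ n fun p : ℝ × E² => p.2 1 - uncurry φ (p.1, p.2 0) :=
    ((contDiff_coord 1).comp contDiff_snd).sub
      (hφ.comp (contDiff_fst.prodMk ((contDiff_coord 0).comp contDiff_snd)))
  exact contDiff_vec2 h1 h2

/-- **The vertical shear velocity is as smooth as the time derivative of the profile.**
[folklore] -/
theorem contDiff_uncurry_vShearVelocity {φt : ℝ → ℝ → ℝ} (hφ : ContDiff ℝ n (uncurry φt)) :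
    ContDiff ℝ n (uncurry (vShearVelocity φt)) := by
  have h1 : ContDiff ℝ n fun p : ℝ × E² => uncurry φt (p.1, p.2 0) :=
    hφ.comp (contDiff_fst.prodMk ((contDiff_coord 0).comp contDiff_snd))
  exact contDiff_vec2 contDiff_const h1

/-- **The axial pullback is smooth** when `Ξ` and the (nowhere vanishing) datum `Ξₓ` are, jointly
in `(t, x)`. [folklore] -/
theorem contDiff_uncurry_axialPullback {Ξ Ξx : ℝ → ℝ → ℝ} {c : ℝ} (hΞ : ContDiff ℝ n (uncurry Ξ))
    (hΞx : ContDiff ℝ n (uncurry Ξx)) (hne : ∀ t x, Ξx t x ≠ 0) :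
    ContDiff ℝ n (uncurry (axialPullback Ξ Ξx c)) := by
  have h0 : ContDiff ℝ n fun p : ℝ × E² => ((p.1, p.2 0) : ℝ × ℝ) :=
    contDiff_fst.prodMk ((contDiff_coord 0).comp contDiff_snd)
  have h1 : ContDiff ℝ n fun p : ℝ × E² => uncurry Ξ (p.1, p.2 0) := hΞ.comp h0
  have h2 : ContDiff ℝ n fun p : ℝ × E² => c + (p.2 1 - c) / uncurry Ξx (p.1, p.2 0) :=
    contDiff_const.add ((((contDiff_coord 1).comp contDiff_snd).sub contDiff_const).div
      (hΞx.comp h0) fun p => hne p.1 (p.2 0))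
  exact contDiff_vec2 h1 h2

/-- **The axial velocity is smooth** when the rate `g` and the datum `gₓ` are, jointly in
`(t, x)`. [folklore] -/
theorem contDiff_uncurry_axialVelocity {g gx : ℝ → ℝ → ℝ} {c : ℝ} (hg : ContDiff ℝ n (uncurry g))
    (hgx : ContDiff ℝ n (uncurry gx)) : ContDiff ℝ n (uncurry (axialVelocity g gx c)) := by
  have h0 : ContDiff ℝ n fun p : ℝ × E² => ((p.1, p.2 0) : ℝ × ℝ) :=
    contDiff_fst.prodMk ((contDiff_coord 0).comp contDiff_snd)
  have h1 : ContDiff ℝ n fun p : ℝ × E² => uncurry g (p.1, p.2 0) := hg.comp h0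
  have h2 : ContDiff ℝ n fun p : ℝ × E² => -(p.2 1 - c) * uncurry gx (p.1, p.2 0) :=
    (((contDiff_coord 1).comp contDiff_snd).sub contDiff_const).neg.mul (hgx.comp h0)
  exact contDiff_vec2 h1 h2

/-- **The Eulerian rate `-Ξₜ/Ξₓ` is smooth** when `Ξₜ`, `Ξₓ` are and `Ξₓ` does not vanish.
[folklore] -/
theorem contDiff_uncurry_axialRate {Ξx Ξt : ℝ → ℝ → ℝ} (hΞx : ContDiff ℝ n (uncurry Ξx))
    (hΞt : ContDiff ℝ n (uncurry Ξt)) (hne : ∀ t x, Ξx t x ≠ 0) :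
    ContDiff ℝ n (uncurry (axialRate Ξx Ξt)) :=
  hΞt.neg.div hΞx fun p => hne p.1 p.2

/-- **The closed-form derivative of the rate is smooth** under the same hypotheses on all data.
[folklore] -/
theorem contDiff_uncurry_axialRateDeriv {Ξx Ξt Ξxx Ξxt : ℝ → ℝ → ℝ} (hΞx : ContDiff ℝ n (uncurry Ξx))
    (hΞt : ContDiff ℝ n (uncurry Ξt)) (hΞxx : ContDiff ℝ n (uncurry Ξxx))
    (hΞxt : ContDiff ℝ n (uncurry Ξxt)) (hne : ∀ t x, Ξx t x ≠ 0) :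
    ContDiff ℝ n (uncurry (axialRateDeriv Ξx Ξt Ξxx Ξxt)) :=
  ((hΞxt.mul hΞx).sub (hΞt.mul hΞxx)).neg.div (hΞx.pow 2) fun p => pow_ne_zero 2 (hne p.1 p.2)

/-- **A profile moved by a smooth pullback is smooth**: `(t, z) ↦ Θ_ref (Ψ t z)`. [folklore] -/
theorem contDiff_uncurry_comp {Θ : E² → G} {Ψ : ℝ → E² → E²} (hΘ : ContDiff ℝ n Θ)
    (hΨ : ContDiff ℝ n (uncurry Ψ)) : ContDiff ℝ n (uncurry fun t z => Θ (Ψ t z)) :=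
  hΘ.comp hΨ

end Smoothness

end PlanarKinematics

end Literature.Analysis.FluidPDE
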